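import Summits.CriticalPhenomena.PercolationContinuityZ3.Theorems.PercNearOneGluingNoHeavyLowerTailAntitheticCyclePlusBoundaryPieces
import Summits.CriticalPhenomena.PercolationContinuityZ3.Theorems.PercNearOneGluingNoHeavyLowerTailAntitheticCyclePlusChange
import HarnessLib

/-!
# `NoHeavyLowerTail` (stmt-CriticalPhenomena-4575) — antithetic cluster pairs: **THEOREM C′ IS A TREE THEOREM** — the boundary count HB and the
# unconditional change inequality at a degree-2 vertex hung on a cycle through `s` (prim-hp-2 gen 44; HOME/THEOREM-Cprime-delta2-cycle.md §5–§7, §12)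

Support file (`--supports stmt-CriticalPhenomena-4575`, hull-port prover `prim-hp-2`, gen 44).  No definitions, no named facts, no sorries; standard axioms.

SETTING (…CyclePlusChange): `G = H + xy + xz`, `H` the cycle `v 0 = s, …, v (n−1)` with pair set `E₀`, `x` off the cycle, `y = v p ≠ z = v q`
(`0 < p, q < n`), `x ∈ R ∌ s`.  Gen 42 landed THEOREM C′ modulo the hypothesis HB of `CyclePlus.change_nonneg_of_boundary`: the nonnegativity, for every
pair of upper sets `U, W`, of the indicator form over the NON-BULK colourings of the half change family.  This file proves HB:
* `CyclePlus.boundary_count` — **HB**.  Proof: (1) the summand only depends on the trace of `ω` on `E₀ ∪ {e, f}`, so by the slab principle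
  (`CyclePlus.sum_nonneg_of_slab`) it suffices to sum over `ω ⊆ E₀ ∪ {e, f}`; (2) pointwise the indicator term is `𝟙[good] − 𝟙[bad]`; (3) the bad
  colourings are one-change and `ω ↦ iLen ω` injects them into the abstract bad index sets `rbBad`, `brBad` (…CyclePlusBoundaryPieces); (4) the explicit
  arc / co-arc / full / empty colourings inject the forced good index sets `arcGood`, `fullGood` into the good colourings; (5) the abstract threshold count
  `BCount.count` (…AntitheticBoundaryCount) compares the two.
* `Antithetic.cyclePlus_change_nonneg` — **THEOREM C′** (unconditional): `0 ≤ Σ_{ω ∈ tset_E(R,∅), xy ≢ xz} Δ_E(F,G)(ω)` for all monotone `F, G` — CONJECTURE Δ2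
  of MEMO-gen40 §3 for every graph `G` with `G − x` a cycle through `s` (`y, z ≠ s`).
* `Antithetic.cyclePlus_tsum_nonneg_of_chord` — COROLLARY (DEG-2 ELIMINATION, `Contract.good_of_change_nonneg`): if `yz ∉ E₀` and the contracted
  cycle-plus-chord `E₀ + yz` is good for `(R, ∅)`, then `0 ≤ T_E(R, ∅; F, G)` for `E = E₀ + xy + xz`.
[cite: VandenbergHaggstromKahn2005, §1 p. 3 (open cluster `C_s`)]
-/

noncomputable section

namespace Summit.CriticalPhenomena.PercolationContinuityZ3.Theorems

open Literature.Probability.Percolation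
open scoped Classical symmDiff

namespace Antithetic

namespace CyclePlus

variable {V : Type*} [Fintype V] {n : ℕ} {v : ℕ → V} (hn : 3 ≤ n) (hinj : ∀ i j, i < n → j < n → v i = v j → i = j) (hper : v n = v 0)
include hn hinj hper

omit hn hinj hper in
/-- The sign of an indicator term: `(𝟙a − 𝟙b)(𝟙c − 𝟙d) = 𝟙[good] − 𝟙[bad]`. [folklore] -/
theorem indicator_term_eq (a b c d : Prop) :
    ((if a then (1 : ℝ) else 0) - (if b then (1 : ℝ) else 0)) * ((if c then (1 : ℝ) else 0) - (if d then (1 : ℝ) else 0)) =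
      (if (a ∧ c ∧ ¬ b ∧ ¬ d) ∨ (¬ a ∧ ¬ c ∧ b ∧ d) then (1 : ℝ) else 0) - (if (a ∧ ¬ b ∧ ¬ c ∧ d) ∨ (¬ a ∧ b ∧ c ∧ ¬ d) then (1 : ℝ) else 0) := by
  by_cases ha : a <;> by_cases hb : b <;> by_cases hc : c <;> by_cases hd : d <;> simp [ha, hb, hc, hd]

/-- **HB — the boundary count of THEOREM C′.**  For the cycle `v 0 = s, …, v (n−1)`, `y = v p`, `z = v q` (`0 < p, q < n`, `p ≠ q`), markers `e, f` off
the cycle, `R ∌ s` and upper sets `U, W`: the indicator form over the non-bulk colourings of the half change family is nonnegative. [this work] -/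
theorem boundary_count {p q : ℕ} (hp0 : 0 < p) (hpn : p < n) (hq0 : 0 < q) (hqn : q < n) (hpq : p ≠ q) (R : Set V) (hRs : v 0 ∉ R)
    {e f : Sym2 V} (he : e ∉ Cyc.edgeSet n v) (hf : f ∉ Cyc.edgeSet n v) (U W : Set (Set (Sym2 V))) (hU : IsUpperSet U) (hW : IsUpperSet W) :
    0 ≤ ∑ ω ∈ ((Peel.tset (Cyc.edgeSet n v) (v 0) R ∅).filter (fun ω => e ∈ ω ∧ f ∉ ω ∧
          ¬ ((openGraph (ω ∩ Cyc.edgeSet n v)).Reachable (v 0) (v p) ∧ (openGraph (ωᶜ ∩ Cyc.edgeSet n v)).Reachable (v 0) (v q)))).filter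
          (fun ω => ¬ (Cyc.Bulk.iLen n v ω + Cyc.Bulk.jLen n v ω + 2 ≤ n)),
        ((if Pendant.liftSet (v 0) (v p) e (openEdgeCluster (ω ∩ Cyc.edgeSet n v) (v 0)) ∈ U then (1 : ℝ) else 0) -
            (if Pendant.liftSet (v 0) (v q) f (openEdgeCluster (ωᶜ ∩ Cyc.edgeSet n v) (v 0)) ∈ U then (1 : ℝ) else 0)) *
          ((if Pendant.liftSet (v 0) (v p) e (openEdgeCluster (ω ∩ Cyc.edgeSet n v) (v 0)) ∈ W then (1 : ℝ) else 0) -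
            (if Pendant.liftSet (v 0) (v q) f (openEdgeCluster (ωᶜ ∩ Cyc.edgeSet n v) (v 0)) ∈ W then (1 : ℝ) else 0)) := by
  set S := ((Peel.tset (Cyc.edgeSet n v) (v 0) R ∅).filter (fun ω => e ∈ ω ∧ f ∉ ω ∧
          ¬ ((openGraph (ω ∩ Cyc.edgeSet n v)).Reachable (v 0) (v p) ∧ (openGraph (ωᶜ ∩ Cyc.edgeSet n v)).Reachable (v 0) (v q)))).filter
          (fun ω => ¬ (Cyc.Bulk.iLen n v ω + Cyc.Bulk.jLen n v ω + 2 ≤ n)) with hS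
  set X : Set (Sym2 V) → Set (Sym2 V) := fun ω => Pendant.liftSet (v 0) (v p) e (openEdgeCluster (ω ∩ Cyc.edgeSet n v) (v 0)) with hX
  set X' : Set (Sym2 V) → Set (Sym2 V) := fun ω => Pendant.liftSet (v 0) (v q) f (openEdgeCluster (ωᶜ ∩ Cyc.edgeSet n v) (v 0)) with hX'
  set term : Set (Sym2 V) → ℝ := fun ω =>
    ((if X ω ∈ U then (1 : ℝ) else 0) - (if X' ω ∈ U then (1 : ℝ) else 0)) *
      ((if X ω ∈ W then (1 : ℝ) else 0) - (if X' ω ∈ W then (1 : ℝ) else 0)) with hterm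
  show 0 ≤ ∑ ω ∈ S, term ω
  -- degenerate cases: `∅ ∈ U` or `∅ ∈ W` (all terms vanish), `e = f` (no terms)
  by_cases hU0 : ∅ ∈ U
  · refine Finset.sum_nonneg fun ω _ => ?_
    have h1 : ∀ Y : Set (Sym2 V), Y ∈ U := fun Y => hU (Set.empty_subset Y) hU0
    show 0 ≤ ((if X ω ∈ U then (1 : ℝ) else 0) - (if X' ω ∈ U then (1 : ℝ) else 0)) * _
    rw [if_pos (h1 _), if_pos (h1 _), sub_self, zero_mul]
  by_cases hW0 : ∅ ∈ W
  · refine Finset.sum_nonneg fun ω _ => ?_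
    have h1 : ∀ Y : Set (Sym2 V), Y ∈ W := fun Y => hW (Set.empty_subset Y) hW0
    show 0 ≤ _ * ((if X ω ∈ W then (1 : ℝ) else 0) - (if X' ω ∈ W then (1 : ℝ) else 0))
    rw [if_pos (h1 _), if_pos (h1 _), sub_self, mul_zero]
  by_cases hef : e = f
  · subst hef
    refine Finset.sum_nonneg fun ω hω => ?_
    exfalso
    rw [hS, Finset.mem_filter, Finset.mem_filter] at hω
    exact hω.1.2.2.1 hω.1.2.1
  -- the good and bad patterns
  set good : Set (Sym2 V) → Prop := fun ω =>
    (X ω ∈ U ∧ X ω ∈ W ∧ X' ω ∉ U ∧ X' ω ∉ W) ∨ (X ω ∉ U ∧ X ω ∉ W ∧ X' ω ∈ U ∧ X' ω ∈ W) with hgood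
  set bad : Set (Sym2 V) → Prop := fun ω =>
    (X ω ∈ U ∧ X' ω ∉ U ∧ X ω ∉ W ∧ X' ω ∈ W) ∨ (X ω ∉ U ∧ X' ω ∈ U ∧ X ω ∈ W ∧ X' ω ∉ W) with hbad
  have hpt : ∀ ω, term ω = (if good ω then (1 : ℝ) else 0) - (if bad ω then (1 : ℝ) else 0) := fun ω =>
    indicator_term_eq _ _ _ _
  -- (1) slab reduction: it suffices to treat the colourings inside `E' = E₀ ∪ {e, f}`
  set E' : Set (Sym2 V) := insert e (insert f (Cyc.edgeSet n v)) with hE'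
  set T := S.filter (fun ω => ω ⊆ E') with hT
  -- membership in `S` and `T`
  have memS : ∀ ω, ω ∈ S ↔ (ω ∈ Peel.tset (Cyc.edgeSet n v) (v 0) R ∅ ∧ e ∈ ω ∧ f ∉ ω ∧
      ¬ ((openGraph (ω ∩ Cyc.edgeSet n v)).Reachable (v 0) (v p) ∧ (openGraph (ωᶜ ∩ Cyc.edgeSet n v)).Reachable (v 0) (v q))) ∧
      ¬ (Cyc.Bulk.iLen n v ω + Cyc.Bulk.jLen n v ω + 2 ≤ n) := fun ω => by
    rw [hS, Finset.mem_filter, Finset.mem_filter]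
  have memT : ∀ ω, ω ∈ T ↔ ((ω ∈ Peel.tset (Cyc.edgeSet n v) (v 0) R ∅ ∧ e ∈ ω ∧ f ∉ ω ∧
      ¬ ((openGraph (ω ∩ Cyc.edgeSet n v)).Reachable (v 0) (v p) ∧ (openGraph (ωᶜ ∩ Cyc.edgeSet n v)).Reachable (v 0) (v q))) ∧
      ¬ (Cyc.Bulk.iLen n v ω + Cyc.Bulk.jLen n v ω + 2 ≤ n)) ∧ ω ⊆ E' := fun ω => by
    rw [hT, Finset.mem_filter, memS]
  suffices hcore : 0 ≤ ∑ ω ∈ T, term ω by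
    have h1 : ∑ ω ∈ S, term ω = ∑ ω, (if ω ∈ S then term ω else 0) := by
      rw [Finset.sum_ite_mem, Finset.univ_inter]
    rw [h1]
    refine CyclePlus.sum_nonneg_of_slab E'ᶜ _ (fun ω D hD => ?_) ?_
    · -- invariance of the summand under flips outside `E'`
      have hDE : ∀ g ∈ E', g ∉ D := fun g hg hgD => hD hgD hg
      have hD0 : ∀ g ∈ Cyc.edgeSet n v, g ∉ D := fun g hg => hDE g (Set.mem_insert_of_mem _ (Set.mem_insert_of_mem _ hg))
      have I1 : (ω ∆ D) ∩ Cyc.edgeSet n v = ω ∩ Cyc.edgeSet n v := Cyc.Bulk.symmDiff_inter_of_disjoint hD0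
      have I2 : (ω ∆ D)ᶜ ∩ Cyc.edgeSet n v = ωᶜ ∩ Cyc.edgeSet n v := Cyc.Bulk.compl_symmDiff_inter_of_disjoint hD0
      have Ie : e ∈ ω ∆ D ↔ e ∈ ω := by
        rw [Cyc.mem_symmDiff_iff' ω]
        have := hDE e (Set.mem_insert _ _)
        tauto
      have If : f ∈ ω ∆ D ↔ f ∈ ω := by
        rw [Cyc.mem_symmDiff_iff' ω]
        have := hDE f (Set.mem_insert_of_mem _ (Set.mem_insert _ _))
        tauto
      have Iedge : ∀ k, k < n → (Cyc.edge v k ∈ ω ∆ D ↔ Cyc.edge v k ∈ ω) := fun k hk => by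
        rw [Cyc.mem_symmDiff_iff' ω]
        have := hD0 _ ⟨k, hk, rfl⟩
        tauto
      have IiLen := Cyc.Bulk.iLen_congr ω (ω ∆ D) (by omega) Iedge
      have IjLen := Cyc.Bulk.jLen_congr ω (ω ∆ D) (by omega) Iedge
      have hmem : ω ∆ D ∈ S ↔ ω ∈ S := by
        simp only [hS, Finset.mem_filter, Peel.mem_tset, I1, I2, Ie, If, IiLen, IjLen]
      have ht : term (ω ∆ D) = term ω := by
        simp only [hterm, hX, hX', I1, I2]
      show (if ω ∆ D ∈ S then term (ω ∆ D) else 0) = (if ω ∈ S then term ω else 0)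
      rw [ht]
      exact if_congr hmem rfl rfl
    · -- the slab over `∅` is `T`
      rw [Finset.sum_ite_mem]
      have hTS : Finset.univ.filter (fun ω : Set (Sym2 V) => ω ∩ E'ᶜ = ∅) ∩ S = T := by
        ext ω
        rw [Finset.mem_inter, Finset.mem_filter, memS, memT, ← Set.disjoint_iff_inter_eq_empty, Set.disjoint_compl_right_iff_subset]
        exact ⟨fun h => ⟨h.2, h.1.2⟩, fun h => ⟨⟨Finset.mem_univ _, h.2⟩, h.1⟩⟩
      rw [hTS]
      exact hcore
  -- (2) the sum is (#good) − (#bad)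
  have hsum : ∑ ω ∈ T, term ω = ((T.filter good).card : ℝ) - ((T.filter bad).card : ℝ) := by
    rw [Finset.sum_congr rfl fun ω _ => hpt ω, Finset.sum_sub_distrib, Finset.sum_boole, Finset.sum_boole]
  rw [hsum, sub_nonneg]
  -- thresholds
  set ar := Cyc.Bulk.thrP n v (v p) e U with har
  set ab := Cyc.Bulk.thrP n v (v q) f U with hab
  set cr := Cyc.Bulk.thrQ n v (v p) e U with hcr
  set cb := Cyc.Bulk.thrQ n v (v q) f U with hcb
  set br := Cyc.Bulk.thrP n v (v p) e W with hbr
  set bb := Cyc.Bulk.thrP n v (v q) f W with hbb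
  set dr := Cyc.Bulk.thrQ n v (v p) e W with hdr
  set db := Cyc.Bulk.thrQ n v (v q) f W with hdb
  have hn1 : 1 ≤ n := by omega
  -- (5) the abstract count
  have key := BCount.count (n := n) (ar := ar) (ab := ab) (cr := cr) (cb := cb) (br := br) (bb := bb) (dr := dr) (db := db) hpn hq0 hqn hpq
    (Cyc.Bulk.one_le_thrP hn1) (Cyc.Bulk.one_le_thrP hn1) (Cyc.Bulk.one_le_thrQ hn1) (Cyc.Bulk.one_le_thrQ hn1)
    (Cyc.Bulk.one_le_thrP hn1) (Cyc.Bulk.one_le_thrP hn1) (Cyc.Bulk.one_le_thrQ hn1) (Cyc.Bulk.one_le_thrQ hn1)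
    Cyc.Bulk.thrP_le Cyc.Bulk.thrP_le Cyc.Bulk.thrQ_le Cyc.Bulk.thrQ_le Cyc.Bulk.thrP_le Cyc.Bulk.thrP_le Cyc.Bulk.thrQ_le Cyc.Bulk.thrQ_le
    (fun h => Cyc.Bulk.thrP_le_of_lt hn hinj hper hU hp0 hpn (v q) f h) (fun h => Cyc.Bulk.thrP_le_of_lt hn hinj hper hU hq0 hqn (v p) e h)
    (fun h => Cyc.Bulk.thrQ_le_of_lt hn hinj hper hU hp0 hpn (v q) f h) (fun h => Cyc.Bulk.thrQ_le_of_lt hn hinj hper hU hq0 hqn (v p) e h)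
    (fun h => Cyc.Bulk.thrP_le_of_lt hn hinj hper hW hp0 hpn (v q) f h) (fun h => Cyc.Bulk.thrP_le_of_lt hn hinj hper hW hq0 hqn (v p) e h)
    (fun h => Cyc.Bulk.thrQ_le_of_lt hn hinj hper hW hp0 hpn (v q) f h) (fun h => Cyc.Bulk.thrQ_le_of_lt hn hinj hper hW hq0 hqn (v p) e h)
  -- (3) the bad colourings inject into the bad index sets by `ω ↦ iLen ω`
  have hbad_le : (T.filter bad).card ≤ (BCount.rbBad n p q ar cb br db).card + (BCount.brBad n p q cr ab dr bb).card := by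
    rw [← Finset.card_filter_add_card_filter_not (s := T.filter bad) (fun ω => Cyc.edge v 0 ∈ ω)]
    refine add_le_add ?_ ?_
    · refine Finset.card_le_card_of_injOn (fun ω => Cyc.Bulk.iLen n v ω) (fun ω hω => ?_) (fun ω₁ hω₁ ω₂ hω₂ hi => ?_)
      · have hω' := Finset.mem_coe.1 hω
        rw [Finset.mem_filter, Finset.mem_filter, memT] at hω'
        obtain ⟨⟨⟨⟨⟨-, -, -, hk⟩, hnb⟩, -⟩, hb⟩, h0⟩ := hω'
        have hnb' := not_le.1 hnb
        have h1 := Cyc.Bulk.last_notMem_of_bad hn hinj hper hq0 hqn hU0 hW0 h0 hnb' (hb.elim (fun h => Or.inr h.2.2.2) fun h => Or.inl h.2.1)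
        exact Finset.mem_coe.2 (Cyc.Bulk.iLen_mem_rbBad hn hinj hper hp0 hpn hq0 hqn hU hW h0 h1 hnb' hk hb)
      · have h₁ := Finset.mem_coe.1 hω₁
        have h₂ := Finset.mem_coe.1 hω₂
        rw [Finset.mem_filter, Finset.mem_filter, memT] at h₁ h₂
        obtain ⟨⟨⟨⟨⟨-, he₁, hf₁, -⟩, hnb₁⟩, hE₁⟩, hb₁⟩, h0₁⟩ := h₁
        obtain ⟨⟨⟨⟨⟨-, he₂, hf₂, -⟩, hnb₂⟩, hE₂⟩, hb₂⟩, h0₂⟩ := h₂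
        have hnb₁' := not_le.1 hnb₁
        have hnb₂' := not_le.1 hnb₂
        have h1₁ := Cyc.Bulk.last_notMem_of_bad hn hinj hper hq0 hqn hU0 hW0 h0₁ hnb₁' (hb₁.elim (fun h => Or.inr h.2.2.2) fun h => Or.inl h.2.1)
        have h1₂ := Cyc.Bulk.last_notMem_of_bad hn hinj hper hq0 hqn hU0 hW0 h0₂ hnb₂' (hb₂.elim (fun h => Or.inr h.2.2.2) fun h => Or.inl h.2.1)
        exact Cyc.Bulk.eq_of_iLen_eq_rb hn hinj hper hE₁ hE₂ he₁ he₂ hf₁ hf₂ h0₁ h1₁ h0₂ h1₂ hnb₁' hnb₂' hi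
    · refine Finset.card_le_card_of_injOn (fun ω => Cyc.Bulk.iLen n v ω) (fun ω hω => ?_) (fun ω₁ hω₁ ω₂ hω₂ hi => ?_)
      · have hω' := Finset.mem_coe.1 hω
        rw [Finset.mem_filter, Finset.mem_filter, memT] at hω'
        obtain ⟨⟨⟨⟨⟨-, -, -, hk⟩, hnb⟩, -⟩, hb⟩, h0⟩ := hω'
        have hnb' := not_le.1 hnb
        have h1 := Cyc.Bulk.last_mem_of_bad hn hinj hper hp0 hpn hU0 hW0 h0 hnb' (hb.elim (fun h => Or.inl h.1) fun h => Or.inr h.2.2.1)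
        exact Finset.mem_coe.2 (Cyc.Bulk.iLen_mem_brBad hn hinj hper hp0 hpn hq0 hqn hU hW h0 h1 hnb' hk hb)
      · have h₁ := Finset.mem_coe.1 hω₁
        have h₂ := Finset.mem_coe.1 hω₂
        rw [Finset.mem_filter, Finset.mem_filter, memT] at h₁ h₂
        obtain ⟨⟨⟨⟨⟨-, he₁, hf₁, -⟩, hnb₁⟩, hE₁⟩, hb₁⟩, h0₁⟩ := h₁
        obtain ⟨⟨⟨⟨⟨-, he₂, hf₂, -⟩, hnb₂⟩, hE₂⟩, hb₂⟩, h0₂⟩ := h₂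
        have hnb₁' := not_le.1 hnb₁
        have hnb₂' := not_le.1 hnb₂
        have h1₁ := Cyc.Bulk.last_mem_of_bad hn hinj hper hp0 hpn hU0 hW0 h0₁ hnb₁' (hb₁.elim (fun h => Or.inl h.1) fun h => Or.inr h.2.2.1)
        have h1₂ := Cyc.Bulk.last_mem_of_bad hn hinj hper hp0 hpn hU0 hW0 h0₂ hnb₂' (hb₂.elim (fun h => Or.inl h.1) fun h => Or.inr h.2.2.1)
        exact Cyc.Bulk.eq_of_iLen_eq_br hn hinj hper hE₁ hE₂ he₁ he₂ hf₁ hf₂ h0₁ h1₁ h0₂ h1₂ hnb₁' hnb₂' hi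
  -- (4) the explicit good colourings
  have memTG : ∀ ω, ω ∈ Peel.tset (Cyc.edgeSet n v) (v 0) R ∅ → e ∈ ω → f ∉ ω →
      ¬ ((openGraph (ω ∩ Cyc.edgeSet n v)).Reachable (v 0) (v p) ∧ (openGraph (ωᶜ ∩ Cyc.edgeSet n v)).Reachable (v 0) (v q)) →
      n < Cyc.Bulk.iLen n v ω + Cyc.Bulk.jLen n v ω + 2 → ω ⊆ E' → good ω → ω ∈ T.filter good := by
    intro ω ht heω hfω hk hnb hsub hg
    rw [Finset.mem_filter, memT]
    exact ⟨⟨⟨⟨ht, heω, hfω, hk⟩, not_le.2 hnb⟩, hsub⟩, hg⟩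
  have split1 := Finset.card_filter_add_card_filter_not (s := T.filter good) (fun ω => Cyc.edge v 0 ∈ ω)
  have splitR := Finset.card_filter_add_card_filter_not (s := (T.filter good).filter (fun ω => Cyc.edge v 0 ∈ ω))
    (fun ω => Cyc.Bulk.iLen n v ω = n)
  have splitB := Finset.card_filter_add_card_filter_not (s := (T.filter good).filter (fun ω => ¬ Cyc.edge v 0 ∈ ω))
    (fun ω => Cyc.Bulk.iLen n v ω = n)
  -- arcs
  have hA : (BCount.arcGood n ar cr br dr).card ≤
      (((T.filter good).filter (fun ω => Cyc.edge v 0 ∈ ω)).filter (fun ω => ¬ Cyc.Bulk.iLen n v ω = n)).card := by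
    refine Finset.card_le_card_of_injOn (fun k => insert e (Cyc.Bulk.runSet n v k (n - 1 - k))) (fun k hk => ?_) (fun k₁ hk₁ k₂ hk₂ hk => ?_)
    · have hk' := Finset.mem_coe.1 hk
      rw [BCount.mem_arcGood] at hk'
      obtain ⟨⟨hk1, hk2⟩, hu, hw⟩ := hk'
      obtain ⟨ht, hein, hfni, hkp, hnb, hsub, h0, hiL, hC, hC'⟩ := Cyc.Bulk.arc_facts hn hinj hper hq0 hqn R hRs he hf hef hk1 (by omega)
      have hXU : X (insert e (Cyc.Bulk.runSet n v k (n - 1 - k))) ∈ U := by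
        show Pendant.liftSet (v 0) (v p) e _ ∈ U
        rw [hC]
        exact hu.elim (fun h => Cyc.Bulk.arc_mem_of_thrP_le hU h (by omega)) fun h => Cyc.Bulk.arc_mem_of_thrQ_le hU h (by omega)
      have hXW : X (insert e (Cyc.Bulk.runSet n v k (n - 1 - k))) ∈ W := by
        show Pendant.liftSet (v 0) (v p) e _ ∈ W
        rw [hC]
        exact hw.elim (fun h => Cyc.Bulk.arc_mem_of_thrP_le hW h (by omega)) fun h => Cyc.Bulk.arc_mem_of_thrQ_le hW h (by omega)
      have hX'0 : X' (insert e (Cyc.Bulk.runSet n v k (n - 1 - k))) = ∅ := by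
        show Pendant.liftSet (v 0) (v q) f _ = ∅
        rw [hC']
        exact Quad.liftSet_of_not (Cyc.Bulk.not_seen_empty hinj hq0 hqn)
      refine Finset.mem_coe.2 (Finset.mem_filter.2 ⟨Finset.mem_filter.2 ⟨memTG _ ht hein hfni hkp hnb hsub (Or.inl ⟨hXU, hXW, ?_, ?_⟩), h0⟩, ?_⟩)
      · rw [hX'0]; exact hU0
      · rw [hX'0]; exact hW0
      · rw [hiL]; omega
    · have h₁ := Finset.mem_coe.1 hk₁
      have h₂ := Finset.mem_coe.1 hk₂
      rw [BCount.mem_arcGood] at h₁ h₂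
      have := congrArg (Cyc.Bulk.iLen n v) hk
      simp only at this
      rwa [Cyc.Bulk.iLen_arc hn hinj hper he h₁.1.1 (by omega), Cyc.Bulk.iLen_arc hn hinj hper he h₂.1.1 (by omega)] at this
  -- co-arcs
  have hB : (BCount.arcGood n ab cb bb db).card ≤
      (((T.filter good).filter (fun ω => ¬ Cyc.edge v 0 ∈ ω)).filter (fun ω => ¬ Cyc.Bulk.iLen n v ω = n)).card := by
    refine Finset.card_le_card_of_injOn (fun k => insert e ({Cyc.edge v k} : Set (Sym2 V))) (fun k hk => ?_) (fun k₁ hk₁ k₂ hk₂ hk => ?_)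
    · have hk' := Finset.mem_coe.1 hk
      rw [BCount.mem_arcGood] at hk'
      obtain ⟨⟨hk1, hk2⟩, hu, hw⟩ := hk'
      obtain ⟨ht, hein, hfni, hkp, hnb, hsub, h0, hiL, hC, hC'⟩ := Cyc.Bulk.coarc_facts hn hinj hper hp0 hpn R hRs he hf hef hk1 (by omega)
      have hXU : X' (insert e {Cyc.edge v k}) ∈ U := by
        show Pendant.liftSet (v 0) (v q) f _ ∈ U
        rw [hC']
        exact hu.elim (fun h => Cyc.Bulk.arc_mem_of_thrP_le hU h (by omega)) fun h => Cyc.Bulk.arc_mem_of_thrQ_le hU h (by omega)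
      have hXW : X' (insert e {Cyc.edge v k}) ∈ W := by
        show Pendant.liftSet (v 0) (v q) f _ ∈ W
        rw [hC']
        exact hw.elim (fun h => Cyc.Bulk.arc_mem_of_thrP_le hW h (by omega)) fun h => Cyc.Bulk.arc_mem_of_thrQ_le hW h (by omega)
      have hX0 : X (insert e {Cyc.edge v k}) = ∅ := by
        show Pendant.liftSet (v 0) (v p) e _ = ∅
        rw [hC]
        exact Quad.liftSet_of_not (Cyc.Bulk.not_seen_empty hinj hp0 hpn)
      refine Finset.mem_coe.2 (Finset.mem_filter.2 ⟨Finset.mem_filter.2 ⟨memTG _ ht hein hfni hkp hnb hsub (Or.inr ⟨?_, ?_, hXU, hXW⟩), h0⟩, ?_⟩)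
      · rw [hX0]; exact hU0
      · rw [hX0]; exact hW0
      · rw [hiL]; omega
    · have h₁ := Finset.mem_coe.1 hk₁
      have h₂ := Finset.mem_coe.1 hk₂
      rw [BCount.mem_arcGood] at h₁ h₂
      have := congrArg (Cyc.Bulk.iLen n v) hk
      simp only at this
      rwa [Cyc.Bulk.iLen_coarc hn hinj hper he h₁.1.1 (by omega), Cyc.Bulk.iLen_coarc hn hinj hper he h₂.1.1 (by omega)] at this
  -- full
  have hF : BCount.fullGood n ar cr br dr ≤ (((T.filter good).filter (fun ω => Cyc.edge v 0 ∈ ω)).filter (fun ω => Cyc.Bulk.iLen n v ω = n)).card := by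
    unfold BCount.fullGood
    split_ifs with hc
    · obtain ⟨ht, hein, hfni, hkp, hnb, hsub, h0, hiL, hC, hC'⟩ := Cyc.Bulk.full_facts hn hinj hper hq0 hqn R hRs (e := e) hf hef
      have hXU : X (insert e (Cyc.edgeSet n v)) ∈ U := by
        show Pendant.liftSet (v 0) (v p) e _ ∈ U
        rw [hC]
        exact hc.1.elim (fun h => Cyc.Bulk.full_mem_of_thrP_lt hU h) fun h => Cyc.Bulk.full_mem_of_thrQ_lt hU h
      have hXW : X (insert e (Cyc.edgeSet n v)) ∈ W := by
        show Pendant.liftSet (v 0) (v p) e _ ∈ W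
        rw [hC]
        exact hc.2.elim (fun h => Cyc.Bulk.full_mem_of_thrP_lt hW h) fun h => Cyc.Bulk.full_mem_of_thrQ_lt hW h
      have hX'0 : X' (insert e (Cyc.edgeSet n v)) = ∅ := by
        show Pendant.liftSet (v 0) (v q) f _ = ∅
        rw [hC']
        exact Quad.liftSet_of_not (Cyc.Bulk.not_seen_empty hinj hq0 hqn)
      refine Finset.card_pos.2 ⟨insert e (Cyc.edgeSet n v), Finset.mem_filter.2 ⟨Finset.mem_filter.2
        ⟨memTG _ ht hein hfni hkp hnb hsub (Or.inl ⟨hXU, hXW, ?_, ?_⟩), h0⟩, hiL⟩⟩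
      · rw [hX'0]; exact hU0
      · rw [hX'0]; exact hW0
    · exact Nat.zero_le _
  -- empty
  have hE : BCount.fullGood n ab cb bb db ≤
      (((T.filter good).filter (fun ω => ¬ Cyc.edge v 0 ∈ ω)).filter (fun ω => Cyc.Bulk.iLen n v ω = n)).card := by
    unfold BCount.fullGood
    split_ifs with hc
    · obtain ⟨ht, hein, hfni, hkp, hnb, hsub, h0, hiL, hC, hC'⟩ := Cyc.Bulk.empty_facts hn hinj hper hp0 hpn R hRs (f := f) he hef
      have hXU : X' {e} ∈ U := by
        show Pendant.liftSet (v 0) (v q) f _ ∈ U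
        rw [hC']
        exact hc.1.elim (fun h => Cyc.Bulk.full_mem_of_thrP_lt hU h) fun h => Cyc.Bulk.full_mem_of_thrQ_lt hU h
      have hXW : X' {e} ∈ W := by
        show Pendant.liftSet (v 0) (v q) f _ ∈ W
        rw [hC']
        exact hc.2.elim (fun h => Cyc.Bulk.full_mem_of_thrP_lt hW h) fun h => Cyc.Bulk.full_mem_of_thrQ_lt hW h
      have hX0 : X {e} = ∅ := by
        show Pendant.liftSet (v 0) (v p) e _ = ∅
        rw [hC]
        exact Quad.liftSet_of_not (Cyc.Bulk.not_seen_empty hinj hp0 hpn)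
      refine Finset.card_pos.2 ⟨{e}, Finset.mem_filter.2 ⟨Finset.mem_filter.2
        ⟨memTG _ ht hein hfni hkp hnb hsub (Or.inr ⟨?_, ?_, hXU, hXW⟩), h0⟩, hiL⟩⟩
      · rw [hX0]; exact hU0
      · rw [hX0]; exact hW0
    · exact Nat.zero_le _
  have hfinal : (T.filter bad).card ≤ (T.filter good).card := by omega
  exact_mod_cast hfinal

/-- **THEOREM C′ (CONJECTURE Δ2 for `G − x` a cycle through `s`).**  Cycle `v 0 = s, …, v (n−1)` (`n ≥ 3`), `x` off the cycle, `y = v p`, `z = v q`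
(`0 < p, q < n`, `p ≠ q`), `E = {xy, xz} ∪ E₀`, `x ∈ R ∌ s`.  For all monotone `F, G` the change part of `Contract.deg2_decomposition` at `x` is nonnegative:
`0 ≤ Σ_{ω ∈ tset_E(R,∅), xy ≢ xz} Δ_E(F,G)(ω)`.  (THEOREM C′ of the theorem file; the case `H` = cycle of CONJECTURE Δ2, MEMO-gen40 §3.) [this work] -/
theorem _root_.Summit.CriticalPhenomena.PercolationContinuityZ3.Theorems.Antithetic.cyclePlus_change_nonneg {x : V} (hx : ∀ i, i < n → v i ≠ x)
    {p q : ℕ} (hp0 : 0 < p) (hpn : p < n) (hq0 : 0 < q) (hqn : q < n) (hpq : p ≠ q) (R : Set V) (hRs : v 0 ∉ R) (hxR : x ∈ R)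
    {F G : Set (Sym2 V) → ℝ} (hF : Monotone F) (hG : Monotone G) :
    0 ≤ ∑ ω ∈ (Peel.tset (insert s(x, v p) (insert s(x, v q) (Cyc.edgeSet n v))) (v 0) R ∅).filter
        (fun ω => ¬ (s(x, v p) ∈ ω ↔ s(x, v q) ∈ ω)),
      Peel.delta F G (insert s(x, v p) (insert s(x, v q) (Cyc.edgeSet n v))) (v 0) ω := by
  have he : s(x, v p) ∉ Cyc.edgeSet n v := notMem_edgeSet_of_mem hper hx (by omega) (Sym2.mem_mk_left x (v p))
  have hf : s(x, v q) ∉ Cyc.edgeSet n v := notMem_edgeSet_of_mem hper hx (by omega) (Sym2.mem_mk_left x (v q))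
  exact change_nonneg_of_boundary hper hx hn hinj hp0 hpn hq0 hqn hpq R hRs hxR hF hG fun U W hU hW =>
    boundary_count hn hinj hper hp0 hpn hq0 hqn hpq R hRs (e := s(x, v p)) (f := s(x, v q)) he hf U W hU hW

/-- **COROLLARY (DEG-2 ELIMINATION on a cycle).**  In the setting of THEOREM C′ with `yz ∉ E₀` (no triangle `xyz`): if the contracted cycle-plus-chord
`E₀ + yz` is good for `(R, ∅)` (`0 ≤ T(R, ∅)` for all monotone functions), then `0 ≤ T_E(R, ∅; F, G)` for `E = E₀ + xy + xz` and all monotone `F, G`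
(`Contract.good_of_change_nonneg`). [this work] -/
theorem _root_.Summit.CriticalPhenomena.PercolationContinuityZ3.Theorems.Antithetic.cyclePlus_tsum_nonneg_of_chord {x : V} (hx : ∀ i, i < n → v i ≠ x)
    {p q : ℕ} (hp0 : 0 < p) (hpn : p < n) (hq0 : 0 < q) (hqn : q < n) (hpq : p ≠ q) (R : Set V) (hRs : v 0 ∉ R) (hxR : x ∈ R)
    (hchord : s(v p, v q) ∉ Cyc.edgeSet n v)
    (hgood : ∀ F' G' : Set (Sym2 V) → ℝ, Monotone F' → Monotone G' → 0 ≤ Peel.tsum F' G' (insert s(v p, v q) (Cyc.edgeSet n v)) (v 0) R ∅)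
    {F G : Set (Sym2 V) → ℝ} (hF : Monotone F) (hG : Monotone G) :
    0 ≤ Peel.tsum F G (insert s(x, v p) (insert s(x, v q) (Cyc.edgeSet n v))) (v 0) R ∅ := by
  have hn0 : 0 < n := by omega
  have hxs : x ≠ v 0 := fun h => hx 0 hn0 h.symm
  have hxy : x ≠ v p := fun h => hx p hpn h.symm
  have hxz : x ≠ v q := fun h => hx q hqn h.symm
  have hyz : v p ≠ v q := fun h => hpq (hinj p q hpn hqn h)
  have he : s(x, v p) ∈ insert s(x, v p) (insert s(x, v q) (Cyc.edgeSet n v)) := Set.mem_insert _ _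
  have hf : s(x, v q) ∈ insert s(x, v p) (insert s(x, v q) (Cyc.edgeSet n v)) := Set.mem_insert_of_mem _ (Set.mem_insert _ _)
  have hg : s(v p, v q) ∉ insert s(x, v p) (insert s(x, v q) (Cyc.edgeSet n v)) := by
    rintro (h | h | h)
    · exact hxz ((Sym2.mem_iff.1 (h ▸ Sym2.mem_mk_left x (v p) : x ∈ s(v p, v q))).elim (fun h' => absurd h' hxy) id)
    · exact hxy ((Sym2.mem_iff.1 (h ▸ Sym2.mem_mk_left x (v q) : x ∈ s(v p, v q))).elim id fun h' => absurd h' hxz)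
    · exact hchord h
  refine Contract.good_of_change_nonneg hxs hxy hxz hyz he hf (deg_two hper hx hn0 (v p) (v q)) hg hF hG R ∅ (Set.notMem_empty x)
    (Antithetic.cyclePlus_change_nonneg hn hinj hper hx hp0 hpn hq0 hqn hpq R hRs hxR hF hG) fun F' G' hF' hG' => ?_
  rw [edgeSet_sdiff_eq hper hx hn0]
  exact hgood F' G' hF' hG'

end CyclePlus

end Antithetic

end Summit.CriticalPhenomena.PercolationContinuityZ3.Theorems
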